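import Mathlib
import HarnessLib
import HarnessLib.Audit
import Summits.AtomisticToContinuum.Statement
import Literature.MathematicalPhysics.StatisticalMechanics.BarlowStackingEnergy
import Literature.Geometry.DiscreteGeometry.FlyspeckL12
import Literature.Geometry.DiscreteGeometry.TameContactGraphs
import Literature.Barriers.AtomisticToContinuum.TetrahedralFrustration

/-!
Route: RadialAperiodicTwin

CLOSED (retired) 2026-08-15T13:45:46Z by operator:999:1257524 — reason: not-a-thesis: assembly does not conclude the sub-problem Statement — note: D-0027 §2.1 audit (human 2026-08-15: routes that do not decide the summit are removed): the assembly concludes `AperiodicRadialPotential`, not the sub-problem statement; a NEW conforming route may be opened from the same idea (generated `closes : … → _root_.Crystallization`).. The file is kept as the record of this route; refuted decls are indexed as negative knowledge (`ledger negatives`).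

# Route RadialAperiodicTwin — a radial sticky-plus-tail potential in R^3 whose designed interlayer
couplings forbid the alignments of an irrational rotation — periodic infimum unattained, no periodic
local limit

NEGATIVE-SIDE TWIN (barrier target, card aperiodic-by-design-radial-polytypes; cf. route
AnomalousDissipation/AveragedCascade for the shape). It suffices to show X: relative to the three
computer-assisted named facts of the Hales programme (flyspeck_L12, Hales2012_contactGraphTame,
Hales_kepler), for every ε > 0 there is a ONE-SPECIES RADIAL pair potential V : ℝ → ℝ on ℝ³ that is
ε-close to the sticky sphere beyond contact (V(1) = −1, V ≥ 1 on [0,1), 0 ≤ V ≤ ε on (1,∞)) and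
HONEST (ground states exist for every N; E(N)/N converges to the infimum e* < 0 of the energy per
particle over periodic configurations) for which BOTH conjuncts of the summit's predicate pair fail:
the periodic infimum is NOT attained (hence ¬HasPeriodicGroundStateEnergy V 3) and ¬IsCrystallizing
V 3. Mechanism: V = finite-wall sticky core + a designed non-negative tail W whose interlayer
registry couplings J_k = barlowCoupling W 1 √(2/3) k (k ≥ 2) are positive exactly at the layer
distances k with {kθ} ∈ (1/3, 2/3) for a fixed irrational θ ∈ (1/3, 1/2): the stacking chain then
FORBIDS THE ALIGNMENTS OF AN IRRATIONAL ROTATION, its zero-energy stackings are exactly the codings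
of the rotation by three arcs (aperiodic, rigid), every periodic stacking pays J_(3pj) > 0, and
rational approximants drive the periodic infimum to the unattained value e₀. X = Target item
AperiodicRadialPotential; the conjunct-(i) half alone is the support item EnergeticTwin.
Lean: `Literature.Geometry.DiscreteGeometry.flyspeck_L12 →
Literature.Geometry.DiscreteGeometry.Hales2012_contactGraphTame →
Literature.Barriers.AtomisticToContinuum.Hales_kepler → ∀ ε : ℝ, 0 < ε → ∃ V : ℝ → ℝ, V 1 = -1 ∧ (∀
r : ℝ, r < 1 → 1 ≤ V r) ∧ (∀ r : ℝ, 1 < r → 0 ≤ V r ∧ V r ≤ ε) ∧ (∀ N : ℕ, ∃ x : Fin N →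
EuclideanSpace ℝ (Fin 3), Literature.MathematicalPhysics.StatisticalMechanics.IsGroundState V x) ∧
(⨅ Q : Literature.MathematicalPhysics.StatisticalMechanics.PeriodicConfiguration 3,
Q.energyPerParticle V) < 0 ∧ Filter.Tendsto (fun N : ℕ =>
Literature.MathematicalPhysics.StatisticalMechanics.groundStateEnergy V 3 N / N) Filter.atTop (nhds
(⨅ Q : Literature.MathematicalPhysics.StatisticalMechanics.PeriodicConfiguration 3,
Q.energyPerParticle V)) ∧ (¬ ∃ P :
Literature.MathematicalPhysics.StatisticalMechanics.PeriodicConfiguration 3, IsLeast (Set.range fun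
Q : Literature.MathematicalPhysics.StatisticalMechanics.PeriodicConfiguration 3 =>
Q.energyPerParticle V) (P.energyPerParticle V)) ∧ ¬
Literature.MathematicalPhysics.StatisticalMechanics.HasPeriodicGroundStateEnergy V 3 ∧ ¬
Literature.MathematicalPhysics.StatisticalMechanics.IsCrystallizing V 3`

## Assembly
Pure logic plus threshold bookkeeping (M := max of the M₀'s and 1, η := min of the η₀'s and ε
divided by the constant C of RegistryRealisation) and two tiny congruences (haggEnergy /
haggStackingEnergy and the window sums of P(J) depend on J_k for k ≥ 2 only, where barlowCoupling W
= J). Given ε: RotationCodedChain gives J with budget η; RegistryRealisation gives W; V := M·1[r<1]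
− 1[r=1] + W. StickyPeriodicReduction (b)+(d) with RotationCodedChain (2) give ⨅_Q e_V(Q) = e₀
(ciInf, BddBelow from (a)); (c) with RotationCodedChain (1) refutes attainment, whence
¬HasPeriodicGroundStateEnergy; (e) with StickyTailHonesty gives existence, e₀ < 0 and E(N)/N → e₀;
BulkStackingReadout with RotationCodedChain (1),(3),(4) gives ¬IsCrystallizing.

Rationale: WHY THIS LINE. The barrier catalogue
(Literature.Barriers.AtomisticToContinuum.AperiodicTilingGroundStates, scope_caveats, audit
2026-08-15) records ONE untouched case of the crystal problem's negative side: one species of point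
particles with a RADIAL pair potential in d = 3; the card proposes to build it next door to the
sticky sphere by the dictionary sticky core ⇒ Barlow layers (Hales2012 kissing-twelve, in tree
modulo flyspeck_L12 + Hales2012_contactGraphTame; ShortRangeStackingBlindness: the core carries no
J_k) ⇒ 1-D chain on letter sequences h_m ∈ ℤ/3 with energy Σ_k J_k·1[h_m = h_(m+k)]
(BarlowStackingEnergy: barlowCoupling, barlowBaseEnergy, haggStackingEnergy) ⇒ designed couplings.
The card's own design lemma (Hubbard / vEKM lattice gas in the paired even sector; arXiv:1906.12103
Thm 4.1/5.2, JedrzejewskiMiekisz2000) is pinned at the particle–hole point (refuter-14): this route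
replaces it by a ROTATION CODING of the full three-letter chain — forbid (J_k > 0) the alignments at
the Bohr set D = {k ≥ 2 : {kθ} ∈ (1/3,2/3)}; the nearest-neighbour exclusion h_(m+1) ≠ h_m and the
third letter do the job of vEKM's finite-range 'no long 0-run' term, there is no vacuum and no
chemical potential, and every proper 3-colouring of the distance graph G(ℤ, D ∪ {1}) is a rotation
coding (each colour class has circular diameter < 1/3) — the regular colourings of
EggletonErdosSkilton1985 / Zhu2002 turned into a uniqueness statement. Imported areas: symbolic
dynamics of rotations / distance-graph colouring (the engine, support RotationCodedChain, provable
now), discrete geometry of packings (Hales 2012 local patterns, Kepler with boundary error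
HalesDSP2012 Thm 6.9 for the readout), lattice-sum bookkeeping (registry design by two radii per
layer distance, support RegistryRealisation). What it does that prior routes do not:
RefuteCrystalPeriodicMin asks the same 1-D question for LJ's own certified J_k (domination expected,
i.e. it expects to close negatively); here J is DESIGNED, the 1-D step is a theorem, and the load
moves to two 3-D accounting statements (cruxes 2–3) that every sticky-heritage route needs anyway;
the negatives index is empty.

RANKED CRUXES. #0 AperiodicRadialPotential (target) — X of § Thesis: flyspeck_L12 →
Hales2012_contactGraphTame → Hales_kepler → ∀ ε > 0 ∃ V radial, ε-close to the sticky sphere beyond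
contact, with ground states ∀ N, ⨅_Q e_V(Q) < 0, E(N)/N → ⨅_Q e_V(Q), the periodic infimum NOT
attained, ¬HasPeriodicGroundStateEnergy V 3 and ¬IsCrystallizing V 3. (why it might fail: the
(ii)-half needs BulkStackingReadout (mesoscopic defect-freeness of sticky ground states with a tail
— an exchange argument nobody has written in 3-D); the (i)-half needs the defect accounting of
StickyPeriodicReduction.) [arXiv:1906.12103, Hales2012, HalesDSP2012, BlancLewin2015,
doi:10.1016/0095-8956(85)90039-5]
#2 StickyPeriodicReduction (crux) — STICKY + TAIL ACCOUNTING (periodic and finite form). Relative to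
flyspeck_L12 and Hales2012_contactGraphTame there are M₀, η₀, C such that for every wall height M ≥
M₀ and every continuous tail 0 ≤ W ≤ η e^(−r²) (η ≤ η₀) vanishing on [0, 3/2] with non-negative
registry couplings J_k = barlowCoupling W 1 √(2/3) k (k ≥ 2), the potential V = M·1[r<1] − 1[r=1] +
W·1[r>1] satisfies: (a) the periodic energies per particle are bounded below; (b) e_V(Q) ≥ e₀ :=
barlowBaseEnergy V 1 √(2/3) for EVERY periodic configuration Q; (c) equality forces Q to be a
kissing-twelve Barlow periodic configuration whose (periodic) Hägg sequence has stacking energy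
density 0; (d) every periodic Hägg sequence s is realised by a periodic configuration with e_V = e₀
+ haggStackingEnergy J s; (e) no finite cluster beats the bulk: 𝓔_N(x) ≥ N e₀ − C N^(2/3) for all
injective x. Proof plan: overlap removal (support OverlapRemoval) ⇒ unit packings; kissing ≤ 12
(L12) ⇒ contact deficit ≥ 1/2 per defective particle; particles at distance ≥ r from all defects
have Barlow r-environments (Hales 2012 Thm 1 local form + local layer propagation) whose
W-site-energy is ≥ e₀^W − tail(r) POINTWISE because J ≥ 0; summing, defects cost ≥ 1/2 − C·m₃(W) > 0
each (third moment of the shell masses of W); equality ⇒ kissing-twelve everywhere ⇒ Barlow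
(FejesTothKissingTwelve) with ideal spacings; energy identity
barlowSiteEnergy_average_eq_haggEnergy. [deps: OverlapRemoval] [difficulty: XL] (why it might fail:
needs a LOCAL Hales/DSP layer theorem (12-kissed up to radius r ⇒ Barlow patch of radius r − O(1))
and a defect accounting where sparse defects of a periodic packing never harvest > (1/2 − C·m₃(W))
each from the tail; defects re-phasing a whole slab's registry would break (b).) [Hales2012,
HalesDSP2012, BlancLewin2015, HeitmannRadin1980,
Literature.Barriers.AtomisticToContinuum.KissingTwelveDegeneracy,
Literature.Barriers.AtomisticToContinuum.ShortRangeStackingBlindness]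
#3 BulkStackingReadout (crux) — NO PERIODIC LOCAL LIMIT. Relative to flyspeck_L12,
Hales2012_contactGraphTame and Hales_kepler there are M₀, η₀ such that for M ≥ M₀ and every tail W
as in crux 2 whose couplings J = barlowCoupling W 1 √(2/3) satisfy (i) J_k ≥ 0 (k ≥ 2), (ii) some
Hägg sequence has zero forward energy at every site (haggEnergy n J (shift s₀) = 0), (iii) the
ANTI-LOCKING property P(J): for every budget B and period p there is L such that any window of L
consecutive layers that is fully aligned at distance p carries internal stacking energy > B — if
ground states of V exist for every N then ¬IsCrystallizing V 3. Proof plan: defect budget D =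
O(N^(2/3)) from the zero-energy trial stacking; MESOSCOPIC RIGIDITY: every R-ball of a ground state
holds ≤ C R² defective particles (exchange with an FCC patch; particle count controlled by
Hales_kepler applied to the limiting periodic packing); hence a periodic local limit P is a
kissing-twelve periodic packing, i.e. Barlow with periodic Hägg word (FejesTothKissingTwelve +
exists_haggSeq_period_of_points_eq), whose period-p alignments would appear along arbitrarily long
layer windows of the approximating ground states; a column re-stacking exchange (cost ∝ perimeter ×
height, gain ∝ area × excess) bounds the internal excess of every window, contradicting P(J). [deps:
StickyPeriodicReduction, RotationCodedChain] [difficulty: XL] (why it might fail: the two exchange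
lemmas are unproved even for W = 0 (3-D sticky spheres: interior defect-freeness of max-contact
clusters is open folklore); a ground-state sequence with defect clusters of size N^(2/9) arranged
periodically, or thin columnar grains, must be excluded by energy, not by counting.) [HalesDSP2012,
Hales2012, BlancLewin2015, HeitmannRadin1980,
Literature.Barriers.AtomisticToContinuum.StickySphereClusters, arXiv:1906.12103]
#9 RotationCodedChain (support) — THE ENGINE (1-D design lemma, provable now). For every budget η >
0 there are couplings J ≥ 0 with J₀ = J₁ = 0 and Σ 4^(k²) J_k ≤ η such that (1) every PERIODIC Hägg
sequence has haggStackingEnergy J s > 0; (2) periodic Hägg sequences of arbitrarily small stacking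
energy exist; (3) some Hägg sequence has zero forward energy at every site (all shifts); (4) the
anti-locking property P(J) of crux 3. Construction: θ ∈ (1/3,1/2) irrational, J_k :=
4^(−k²)/k²·(scale) for k ≥ 2 with {kθ} ∈ (1/3,2/3), else 0. Zero-energy letter sequences = codings m
↦ arc of φ + mθ for the three arcs of length 1/3 (points at circular distance ≥ 1/3 never share a
half-open arc); a p-periodic Hägg sequence has 3p-periodic letters, hence alignments at every
distance 3pj, and some j has {3pjθ} ∈ (1/3,2/3) (density of the orbit), so its density is ≥ J_(3pj)
> 0; rational codings a/q → θ give periodic sequences with energy ≤ Σ_(k>K(q)) J_k → 0; a fully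
p-aligned window of length L contains ≥ L − jp internal violations at distance jp, each costing
J_(jp). [difficulty: M] [EggletonErdosSkilton1985, doi:10.1016/0095-8956(85)90039-5, Zhu2002,
doi:10.1002/jgt.10062, arXiv:1906.12103, RadinSchulman1983, Radin1991]
#9 RegistryRealisation (support) — INVERSION J ↦ W. There is C such that every target J with J₀ = J₁
= 0 and Σ 4^(k²)|J_k| ≤ η is realised EXACTLY (barlowCoupling W 1 √(2/3) k = J_k, k ≥ 2) by a
continuous tail 0 ≤ W ≤ Cη e^(−r²) vanishing on [0, 3/2]. Construction: two radii per layer distance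
k — r⁺_k = k√(2/3) (the on-axis aligned point, registry coefficient +1) and r⁻_k = √((2k²+1)/3) (the
three nearest non-aligned points, coefficient −3) — carrying non-negative bumps of width 1/(100k)
(all squared Barlow distances lie in (1/3)ℕ, so shells are isolated); a shell of radius <
(k+1)√(2/3) touches only layers ≤ k (strictly triangular), cross-talk counts are ≤ C·k, and with the
weight 4^(k²) the downward solve is a contraction; signs are chosen by which radius carries the
mass. [difficulty: M] [BlancLewin2015, PartayOrtnerCsanyi2017,
Literature.Barriers.AtomisticToContinuum.ShortRangeStackingBlindness]
#9 OverlapRemoval (support) — FINITE WALLS ENCODE THE HARD CORE. (a) In any finite configuration of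
ℝ³ the number of unit-distance pairs is ≤ A·N + B·#(pairs at distance < 1) (grid of cubes of side
1/2: U ≤ 343·X + 172·N); (b) hence for M ≥ M₀ and any tail 0 ≤ W ≤ e^(−r²) every ground state of V =
M·1[r<1] − 1[r=1] + W·1[r>1] is a unit packing (remove all overlap-affected particles — they carry ≤
13·(their number) outside contacts since clean neighbours kiss ≤ 12 — and re-insert them as a far
FCC blob; W ≥ 0 makes removal free). [difficulty: provable-now] [BlancLewin2015, Hales2012]
#9 StickyTailHonesty (support) — HONESTY OF THE WITNESS. For M ≥ M₀ and tails W as in crux 2 with J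
≥ 0 (k ≥ 2) and a zero-energy Hägg word: ground states exist for every N (overlap removal + strict
binding: one new contact beats the Gaussian cross-tail; lower semicontinuity of −#contacts + W on
unit packings; no splitting), e₀ = barlowBaseEnergy V 1 √(2/3) < 0 (= −6 + O(η)), and E(N)/N ≤ e₀ +
δ eventually (trial states: N-point fragments of the zero-energy coded Barlow stacking, surface
O(N^(2/3))). [difficulty: M] [BlancLewin2015, HeitmannRadin1980, Theil2006]
#9 EnergeticTwin (support) — THE CONJUNCT-(i) TWIN ALONE (closes with crux 2 + the three M-supports,
without crux 3): relative to flyspeck_L12 and Hales2012_contactGraphTame, for every ε > 0 a radial V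
ε-close to the sticky sphere with ground states ∀ N, ⨅_Q e_V(Q) < 0, E(N)/N → ⨅_Q e_V(Q), periodic
infimum NOT attained, ¬HasPeriodicGroundStateEnergy V 3. Fills the catalogue's open seat on the
energetic side and calibrates route RefuteCrystalPeriodicMin's logic on a potential where it is
true. [difficulty: L] [arXiv:1906.12103, BlancLewin2015, Radin1991, Suto2006]

TWO-LAYER PLAN. Foreseen glued splits (filed only when a crux moves): StickyPeriodicReduction ⇐
LocalLayerTheorem (12-kissed on B_(r+c) ⇒ Barlow patch on B_r, from Hales2012_kissingConfigCongruent
+ LayerPropagation in local form) → DefectAccounting (site energy ≥ e₀^W − tail(dist to defects),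
third-moment sum) → StickyPeriodicReduction; BulkStackingReadout ⇐ MesoscopicDefectBound (≤ C R²
defects per R-ball of a ground state; Kepler exchange) → ColumnRestackingBound (internal window
excess ≤ B₀) → BulkStackingReadout (k ≤ 3, depth 1).

KILL CRITERIA. Refutation of StickyPeriodicReduction (b) by an η₀-uniform family of defective
periodic packings beating e₀ closes the route (`refuted:StickyPeriodicReduction`) and is itself a
barrier fact worth filing (tails cannot be charged to a defect budget). Refutation of
BulkStackingReadout alone (e.g. ground states of sticky + tail with periodic defect superstructures)
⇒ pivot: keep EnergeticTwin as the route's deliverable and re-target (ii) to 'no DEFECT-FREE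
periodic local limit'. RotationCodedChain refuted (it should not be: the proof is on paper in NOTES)
⇒ revert to the card's even-sector designs. A proof elsewhere that every stable radial V with ground
states ∀ N has an attained periodic infimum would refute the Target outright — and would be a major
positive theorem.

NOT DECOMPOSED YET. Deliberately not filed: the local layer theorem and the defect-accounting
inequality (children of crux 2); the mesoscopic defect bound and the column re-stacking bound
(children of crux 3); the energy identity energyPerParticle(barlowPeriodicConfiguration) = e₀ + p⁻¹
haggEnergy p J s (bookkeeping inside crux 2 (c),(d), flagged 'not proved here' in
BarlowStackingEnergy); quantitative constants M₀ ≈ 1300 (overlap removal), η₀ (third moment of W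
below 1/(4C)); the slower-decay version of RegistryRealisation (weight e^(ck) instead of 4^(k²), via
radii chosen by congruence conditions on Löschian numbers) — not needed by this assembly.

CHEAPEST FALSIFIER. (1) A certified min-mean-cycle (Karp) scan of the TRUNCATED coded chain J^(K) (k
≤ K = 12…40, θ = (√5−1)/2·… any irrational in (1/3,1/2)): ground words of the truncation must be
periodic (finite range) with periods GROWING with K and energy density → 0 — if instead the
truncations lock onto one period for all K the on-paper proof of RotationCodedChain (1)–(2) is
wrong; a one-hour kit job. (2) For crux 2: evaluate, for the realised W (K = 8 suffices), the
W-energy of the periodic 'vacancy superlattice' of HCP and of a Σ3 twin-boundary superlattice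
against e₀: any value below e₀ kills (b). Neither was run this session (kit not in a plancard seat's
remit; recorded for the refuter).

NUMBERS. Sticky reference: e₀ = −6 + e₀^W, kissing 12 (flyspeck_L12, h₀ = 1.26), Barlow squared
distances ∈ (1/3)ℕ: 1, 2, 8/3, 3, 11/3, 4, …; design radii r⁺_k = k√(2/3) (k = 2: 1.633), r⁻_k =
√((2k²+1)/3) (k = 2: √3); registry coefficients +1 / −3; overlap-removal constants U ≤ 343·X +
172·N, wall M₀ ≈ 1300; weight 4^(k²) (cross-talk ≤ C·k per shell makes the triangular solve contract
by 3·4^(−5) at k = 2). Items at open: 9 (1 target, 2 cruxes, 5 support, 1 assembly).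

DEFINITION REQUESTS. None needed to state the items (IsHaggSeq, HaggAligned, haggEnergy,
haggStackingEnergy, barlowCoupling, barlowBaseEnergy, PeriodicConfiguration, IsGroundState,
IsCrystallizing, flyspeck_L12, Hales2012_contactGraphTame, Hales_kepler all exist). Nice-to-have for
provers of crux 2/3: a Literature lemma `energyPerParticle_barlowPeriodicConfiguration` (the
regrouping flagged 'not proved here' in BarlowStackingEnergy) and a LOCAL form of
HalesDSP_layerPackings.

Novelty: Searches (2026-08-15; searchd down, OpenAlex/S2/arXiv legs rate-limited, zbMATH + Crossref + galaxy
live): `lit search --source zbmath "nonperiodic ground states one-dimensional lattice"` (3;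
Miekisz1998), `--source crossref "non-periodic ground states one-dimensional two-body interactions
lattice gas"` (11; GlodkowskiMiekisz2024 doi:10.1007/s10955-024-03388-4, Oleksy–Lorenc
doi:10.1103/physrevb.54.5955, Coquet–Dinda doi:10.1080/01411599108207964), `--source crossref
"theory of polytypism … devil's staircase Bruinsma Zangwill"` (10; Bruinsma1989
doi:10.1080/01411598908245703, Bruinsma–Bak doi:10.1103/physrevb.27.5824, Jedrzejewski–Miekisz
doi:10.1209/epl/i2000-00271-3), `--source zbmath "Kerimov ground states one-dimensional long-range"`
(4; doi:10.1063/5.0001423 zero-field AF chain criteria), `--source zbmath "colouring the real line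
distance graphs"` (5; EggletonErdosSkilton1985 doi:10.1016/0095-8956(85)90039-5), `--source crossref
"circular chromatic number distance graphs regular coloring"` (8; Zhu2002 doi:10.1002/jgt.10062),
`lit galaxy search "nonperiodic ground states" / "theory of polytypism" / "aperiodic ground state
one-component isotropic pair potential" --star all` (noise only), `lit frontier AtomisticToContinuum
--since 2020` (30; crystallization rows arXiv:2407.20762, arXiv:2604.19239 — 2-D / polycrystal
emergence, not the negative side), vEKM arXiv:1906.12103 §4–5 read in full (materialised).
Nearest prior art found: arXiv:1906.12103 (van Enter–Koivusalo–Miękis  [refs: 10.1007/s10955-024-03388-4, 10.1103/physrevb.54.5955, 10.1080/01411599108207964, 10.1080/01411598908245703, 10.1103/physrevb.27.5824, 10.1209/epl/i2000-00271-3, 10.1063/5.0001423, 10.1016/0095-8956(85, 10.1002/jgt.10062, 2407.20762, 2604.19239, 1906.12103, doi:10.1007/s10955-024-03388-4, doi:10.1103/physrevb.54.5955, doi:10.1080/01411599108207964, doi:10.1080/01411598908245703, doi:10.1103/physrev]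

Barriers (technique_class: designed-potential; hagg-sequence-reduction; rotation-coding): - technique_class: designed-potential; hagg-sequence-reduction; rotation-coding
- Literature.Barriers.AtomisticToContinuum.AperiodicTilingGroundStates: not evaded but EXTENDED —
the route proposes to fill its recorded open seat (one species, radial, d = 3) by a construction; it
inherits the barrier's lesson that forced aperiodicity coexists with non-empty ground-state sets
(ground states ∀ N are part of the Target).
- Literature.Barriers.AtomisticToContinuum.Hubbard1978_mostHomogeneous: EVADED rather than used —
its lesson (aperiodicity only at a prescribed irrational density or an exceptional chemical
potential; the symmetric point of the card's even-sector lattice gas is pinned) is exactly why the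
engine is a three-letter rotation coding whose irrational parameter is a rotation number, not a
density; no chemical potential is tuned.
- Literature.Barriers.AtomisticToContinuum.KissingTwelveDegeneracy: USED — twelve contacts force
layers but no stacking; the designed tail writes the stacking rule on this blank tape; periodic
Barlow ⇒ periodic Hägg word (exists_haggSeq_period_of_points_eq) is an input of crux 3.
- Literature.Barriers.AtomisticToContinuum.ShortRangeStackingBlindness: USED — the sticky core
contributes no J_k (k ≥ 2), so every registry coupling is the tail's, and the tail vanishes on [0,
3/2].
- Literature.Barriers.AtomisticToContinuum.SutoDegenerateGroundStates: contrasted — Sütő's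
degenerate stealthy ground states always include lattices attaining the minimum; h

History (route lifecycle, newest last):
- 2026-08-15T13:45:46Z · CLOSED retired — not-a-thesis: assembly does not conclude the sub-problem Statement (operator:999:1257524)

sub-problem: Crystallization · status: closed(retired) · opened planner-plancard-AtomisticToContinuum-Crystal-688a8e04-0 2026-08-15T12:08:17Z · rev 0 · ledger route-AtomisticToContinuum-RadialAperiodicTwin
GENERATED by the gate from the ledger (D-0016/17). Provers cite these decls: `theorem foo : Summit.AtomisticToContinuum.Crystallization.Theses.RadialAperiodicTwin.<Decl> := …` in Summits/AtomisticToContinuum/Crystallization/Theorems/<Name>.lean.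
-/

namespace Summit.AtomisticToContinuum.Crystallization.Theses.RadialAperiodicTwin

open scoped BigOperators Topology Manifold Classical MeasureTheory ProbabilityTheory Matrix InnerProductSpace ComplexConjugate ContinuousMap
open Filter Set Function TopologicalSpace MeasureTheory

attribute [summit_statement] _root_.Crystallization

/-- item stmt-AtomisticToContinuum-7337 · target · rank 0 · closed · moot by None · by planner
why it might fail: the (ii)-half needs BulkStackingReadout (mesoscopic defect-freeness of sticky ground states with a tail — an exchange argument nobody has written in 3-D); the (i)-half needs the defect accounting of StickyPeriodicReduction.
sources: arXiv:1906.12103, Hales2012, HalesDSP2012, BlancLewin2015, doi:10.1016/0095-8956(85)90039-5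
[target] X of § Thesis: flyspeck_L12 → Hales2012_contactGraphTame → Hales_kepler → ∀ ε > 0 ∃ V
radial, ε-close to the sticky sphere beyond contact, with ground states ∀ N, ⨅_Q e_V(Q) < 0, E(N)/N
→ ⨅_Q e_V(Q), the periodic infimum NOT attained, ¬HasPeriodicGroundStateEnergy V 3 and
¬IsCrystallizing V 3. -/
@[route_item "route-AtomisticToContinuum-RadialAperiodicTwin"]
def AperiodicRadialPotential : Prop :=
  Literature.Geometry.DiscreteGeometry.flyspeck_L12 → Literature.Geometry.DiscreteGeometry.Hales2012_contactGraphTame → Literature.Barriers.AtomisticToContinuum.Hales_kepler → ∀ ε : ℝ, 0 < ε → ∃ V : ℝ → ℝ, V 1 = -1 ∧ (∀ r : ℝ, r < 1 → 1 ≤ V r) ∧ (∀ r : ℝ, 1 < r → 0 ≤ V r ∧ V r ≤ ε) ∧ (∀ N : ℕ, ∃ x : Fin N → EuclideanSpace ℝ (Fin 3), Literature.MathematicalPhysics.StatisticalMechanics.IsGroundState V x) ∧ (⨅ Q : Literature.MathematicalPhysics.StatisticalMechanics.PeriodicConfiguration 3, Q.energyPerParticle V) < 0 ∧ Filter.Tendsto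 (fun N : ℕ => Literature.MathematicalPhysics.StatisticalMechanics.groundStateEnergy V 3 N / N) Filter.atTop (nhds (⨅ Q : Literature.MathematicalPhysics.StatisticalMechanics.PeriodicConfiguration 3, Q.energyPerParticle V)) ∧ (¬ ∃ P : Literature.MathematicalPhysics.StatisticalMechanics.PeriodicConfiguration 3, IsLeast (Set.range fun Q : Literature.MathematicalPhysics.StatisticalMechanics.PeriodicConfiguration 3 => Q.energyPerParticle V) (P.energyPerParticle V)) ∧ ¬ Literature.MathematicalPhysics.StatisticalMechanics.HasPeriodicGroundStateEnergy V 3 ∧ ¬ Literature.MathematicalPhysics.StatisticalMechanics.IsCrystallizing V 3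

/-- item stmt-AtomisticToContinuum-7338 · crux · rank 2 · closed · moot by None · by planner
why it might fail: needs a LOCAL Hales/DSP layer theorem (12-kissed up to radius r ⇒ Barlow patch of radius r − O(1)) and a defect accounting where sparse defects of a periodic packing never harvest > (1/2 − C·m₃(W)) each from the tail; defects re-phasing a whole slab's registry would break (b).
sources: Hales2012, HalesDSP2012, BlancLewin2015, HeitmannRadin1980, Literature.Barriers.AtomisticToContinuum.KissingTwelveDegeneracy, Literature.Barriers.AtomisticToContinuum.ShortRangeStackingBlindness
[crux] STICKY + TAIL ACCOUNTING (periodic and finite form). Relative to flyspeck_L12 and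
Hales2012_contactGraphTame there are M₀, η₀, C such that for every wall height M ≥ M₀ and every
continuous tail 0 ≤ W ≤ η e^(−r²) (η ≤ η₀) vanishing on [0, 3/2] with non-negative registry
couplings J_k = barlowCoupling W 1 √(2/3) k (k ≥ 2), the potential V = M·1[r<1] − 1[r=1] + W·1[r>1]
satisfies: (a) the periodic energies per particle are bounded below; (b) e_V(Q) ≥ e₀ :=
barlowBaseEnergy V 1 √(2/3) for EVERY periodic configuration Q; (c) equality forces Q to be a
kissing-twelve Barlow periodic configuration whose (periodic) Hägg sequence has stacking energy
density 0; (d) every periodic Hägg sequence s is realised by a periodic configuration with e_V = e₀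
+ haggStackingEnergy J s; (e) no finite cluster beats the bulk: 𝓔_N(x) ≥ N e₀ − C N^(2/3) for all
injective x. Proof plan: overlap removal (support OverlapRemoval) ⇒ unit packings; kissing ≤ 12
(L12) ⇒ contact deficit ≥ 1/2 per defective particle; particles at distance ≥ r from all defects
have Barlow r-environments (Hales 2012 Thm 1 local form + local layer propagation) whose
W-site-energy is ≥ e₀^W − tail(r) POINTWISE because J ≥ 0; summin -/
@[route_item "route-AtomisticToContinuum-RadialAperiodicTwin"]
def StickyPeriodicReduction : Prop :=
  Literature.Geometry.DiscreteGeometry.flyspeck_L12 → Literature.Geometry.DiscreteGeometry.Hales2012_contactGraphTame → ∃ M₀ η₀ C : ℝ, 0 < η₀ ∧ ∀ (M η : ℝ) (W : ℝ → ℝ), M₀ ≤ M → 0 < η → η ≤ η₀ → Continuous W → (∀ r : ℝ, 0 ≤ W r ∧ W r ≤ η * Real.exp (-r ^ 2)) → (∀ r : ℝ, r ≤ 3 / 2 → W r = 0) → (∀ k : ℕ, 2 ≤ k → 0 ≤ Literature.MathematicalPhysics.StatisticalMechanics.barlowCoupling W 1 (Real.sqrt (2 / 3)) k) → let V : ℝ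 → ℝ := fun r => if r < 1 then M else if r = 1 then -1 else W r; (BddBelow (Set.range fun Q : Literature.MathematicalPhysics.StatisticalMechanics.PeriodicConfiguration 3 => Q.energyPerParticle V)) ∧ (∀ Q : Literature.MathematicalPhysics.StatisticalMechanics.PeriodicConfiguration 3, Literature.MathematicalPhysics.StatisticalMechanics.barlowBaseEnergy V 1 (Real.sqrt (2 / 3)) ≤ Q.energyPerParticle V) ∧ (∀ Q : Literature.MathematicalPhysics.StatisticalMechanics.PeriodicConfiguration 3, Q.energyPerParticle V = Literature.MathematicalPhysics.StatisticalMechanics.barlowBaseEnergy V 1 (Real.sqrt (2 / 3)) → ∃ (s : ℤ → ℤ) (p : ℕ), Literature.MathematicalPhysics.StatisticalMechanics.IsHaggSeq s ∧ 0 < p ∧ (∀ i : ℤ, s (i + p) = s i) ∧ Literature.MathematicalPhysics.StatisticalMechanics.haggStackingEnergy (Literature.MathematicalPhysics.StatisticalMechanics.barlowCoupling W 1 (Real.sqrt (2 / 3))) s = 0) ∧ (∀ (s : ℤ → ℤ) (p : ℕ), Literature.MathematicalPhysics.StatisticalMechanics.IsHaggSeq s → 0 < p → (∀ i : ℤ,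 s (i + p) = s i) → ∃ Q : Literature.MathematicalPhysics.StatisticalMechanics.PeriodicConfiguration 3, Q.energyPerParticle V = Literature.MathematicalPhysics.StatisticalMechanics.barlowBaseEnergy V 1 (Real.sqrt (2 / 3)) + Literature.MathematicalPhysics.StatisticalMechanics.haggStackingEnergy (Literature.MathematicalPhysics.StatisticalMechanics.barlowCoupling W 1 (Real.sqrt (2 / 3))) s) ∧ (∀ (N : ℕ) (x : Fin N → EuclideanSpace ℝ (Fin 3)), Function.Injective x → (N : ℝ) * Literature.MathematicalPhysics.StatisticalMechanics.barlowBaseEnergy V 1 (Real.sqrt (2 / 3)) - C * (N : ℝ) ^ (2 / 3 : ℝ) ≤ Literature.MathematicalPhysics.StatisticalMechanics.interactionEnergy V x)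

/-- item stmt-AtomisticToContinuum-7339 · crux · rank 3 · closed · moot by None · by planner
why it might fail: the two exchange lemmas are unproved even for W = 0 (3-D sticky spheres: interior defect-freeness of max-contact clusters is open folklore); a ground-state sequence with defect clusters of size N^(2/9) arranged periodically, or thin columnar grains, must be excluded by energy, not by counting.
sources: HalesDSP2012, Hales2012, BlancLewin2015, HeitmannRadin1980, Literature.Barriers.AtomisticToContinuum.StickySphereClusters, arXiv:1906.12103
[crux] NO PERIODIC LOCAL LIMIT. Relative to flyspeck_L12, Hales2012_contactGraphTame and
Hales_kepler there are M₀, η₀ such that for M ≥ M₀ and every tail W as in crux 2 whose couplings J =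
barlowCoupling W 1 √(2/3) satisfy (i) J_k ≥ 0 (k ≥ 2), (ii) some Hägg sequence has zero forward
energy at every site (haggEnergy n J (shift s₀) = 0), (iii) the ANTI-LOCKING property P(J): for
every budget B and period p there is L such that any window of L consecutive layers that is fully
aligned at distance p carries internal stacking energy > B — if ground states of V exist for every N
then ¬IsCrystallizing V 3. Proof plan: defect budget D = O(N^(2/3)) from the zero-energy trial
stacking; MESOSCOPIC RIGIDITY: every R-ball of a ground state holds ≤ C R² defective particles
(exchange with an FCC patch; particle count controlled by Hales_kepler applied to the limiting
periodic packing); hence a periodic local limit P is a kissing-twelve periodic packing, i.e. Barlow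
with periodic Hägg word (FejesTothKissingTwelve + exists_haggSeq_period_of_points_eq), whose
period-p alignments would appear along arbitrarily long layer windows of the approximating ground
states; a column re-stacking exchange (cost -/
@[route_item "route-AtomisticToContinuum-RadialAperiodicTwin"]
def BulkStackingReadout : Prop :=
  Literature.Geometry.DiscreteGeometry.flyspeck_L12 → Literature.Geometry.DiscreteGeometry.Hales2012_contactGraphTame → Literature.Barriers.AtomisticToContinuum.Hales_kepler → ∃ M₀ η₀ : ℝ, 0 < η₀ ∧ ∀ (M η : ℝ) (W : ℝ → ℝ), M₀ ≤ M → 0 < η → η ≤ η₀ → Continuous W → (∀ r : ℝ, 0 ≤ W r ∧ W r ≤ η * Real.exp (-r ^ 2)) → (∀ r : ℝ, r ≤ 3 / 2 → W r = 0) → let V : ℝ → ℝ := fun r => if r < 1 then M else if r = 1 then -1 else W r; let J : ℕ → ℝ := Literature.MathematicalPhysics.StatisticalMechanics.barlowCoupling W 1 (Real.sqrt (2 / 3)); (∀ k : ℕ, 2 ≤ k → 0 ≤ J k) → (∃ s₀ : ℤ → ℤ, Literature.MathematicalPhysics.StatisticalMechanics.IsHaggSeq s₀ ∧ ∀ (a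 : ℤ) (n : ℕ), Literature.MathematicalPhysics.StatisticalMechanics.haggEnergy n J (fun i => s₀ (i + a)) = 0) → (∀ (B : ℝ) (p : ℕ), 0 < p → ∃ L : ℕ, ∀ (s : ℤ → ℤ) (m₀ : ℤ), Literature.MathematicalPhysics.StatisticalMechanics.IsHaggSeq s → (∀ m : ℕ, m < L → Literature.MathematicalPhysics.StatisticalMechanics.HaggAligned s (m₀ + m) p) → B < ∑ m ∈ Finset.range L, ∑ k ∈ Finset.Icc 2 L, if m + k < L ∧ Literature.MathematicalPhysics.StatisticalMechanics.HaggAligned s (m₀ + m) k then J k else 0) → (∀ N : ℕ, ∃ x : Fin N → EuclideanSpace ℝ (Fin 3), Literature.MathematicalPhysics.StatisticalMechanics.IsGroundState V x) → ¬ Literature.MathematicalPhysics.StatisticalMechanics.IsCrystallizing V 3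

/-- item stmt-AtomisticToContinuum-7340 · support · rank 9 · closed · moot by None · by planner
sources: EggletonErdosSkilton1985, doi:10.1016/0095-8956(85)90039-5, Zhu2002, doi:10.1002/jgt.10062, arXiv:1906.12103, RadinSchulman1983
[support] THE ENGINE (1-D design lemma, provable now). For every budget η > 0 there are couplings J
≥ 0 with J₀ = J₁ = 0 and Σ 4^(k²) J_k ≤ η such that (1) every PERIODIC Hägg sequence has
haggStackingEnergy J s > 0; (2) periodic Hägg sequences of arbitrarily small stacking energy exist;
(3) some Hägg sequence has zero forward energy at every site (all shifts); (4) the anti-locking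
property P(J) of crux 3. Construction: θ ∈ (1/3,1/2) irrational, J_k := 4^(−k²)/k²·(scale) for k ≥ 2
with {kθ} ∈ (1/3,2/3), else 0. Zero-energy letter sequences = codings m ↦ arc of φ + mθ for the
three arcs of length 1/3 (points at circular distance ≥ 1/3 never share a half-open arc); a
p-periodic Hägg sequence has 3p-periodic letters, hence alignments at every distance 3pj, and some j
has {3pjθ} ∈ (1/3,2/3) (density of the orbit), so its density is ≥ J_(3pj) > 0; rational codings a/q
→ θ give periodic sequences with energy ≤ Σ_(k>K(q)) J_k → 0; a fully p-aligned window of length L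
contains ≥ L − jp internal violations at distance jp, each costing J_(jp). [difficulty: M] -/
@[route_item "route-AtomisticToContinuum-RadialAperiodicTwin"]
def RotationCodedChain : Prop :=
  ∀ η : ℝ, 0 < η → ∃ J : ℕ → ℝ, (∀ k : ℕ, 0 ≤ J k) ∧ J 0 = 0 ∧ J 1 = 0 ∧ Summable (fun k : ℕ => (4 : ℝ) ^ (k ^ 2) * J k) ∧ (∑' k : ℕ, (4 : ℝ) ^ (k ^ 2) * J k) ≤ η ∧ (∀ (s : ℤ → ℤ) (p : ℕ), Literature.MathematicalPhysics.StatisticalMechanics.IsHaggSeq s → 0 < p → (∀ i : ℤ, s (i + p) = s i) → 0 < Literature.MathematicalPhysics.StatisticalMechanics.haggStackingEnergy J s) ∧ (∀ ε : ℝ, 0 < ε → ∃ (s : ℤ → ℤ) (p : ℕ), Literature.MathematicalPhysics.StatisticalMechanics.IsHaggSeq s ∧ 0 < p ∧ (∀ i : ℤ, s (i + p) = s i) ∧ Literature.MathematicalPhysics.StatisticalMechanics.haggStackingEnergy J s < ε) ∧ (∃ s₀ : ℤ → ℤ, Literature.MathematicalPhysics.StatisticalMechanics.IsHaggSeq s₀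 ∧ ∀ (a : ℤ) (n : ℕ), Literature.MathematicalPhysics.StatisticalMechanics.haggEnergy n J (fun i => s₀ (i + a)) = 0) ∧ (∀ (B : ℝ) (p : ℕ), 0 < p → ∃ L : ℕ, ∀ (s : ℤ → ℤ) (m₀ : ℤ), Literature.MathematicalPhysics.StatisticalMechanics.IsHaggSeq s → (∀ m : ℕ, m < L → Literature.MathematicalPhysics.StatisticalMechanics.HaggAligned s (m₀ + m) p) → B < ∑ m ∈ Finset.range L, ∑ k ∈ Finset.Icc 2 L, if m + k < L ∧ Literature.MathematicalPhysics.StatisticalMechanics.HaggAligned s (m₀ + m) k then J k else 0)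

/-- item stmt-AtomisticToContinuum-7341 · support · rank 9 · closed · moot by None · by planner
sources: BlancLewin2015, PartayOrtnerCsanyi2017, Literature.Barriers.AtomisticToContinuum.ShortRangeStackingBlindness
[support] INVERSION J ↦ W. There is C such that every target J with J₀ = J₁ = 0 and Σ 4^(k²)|J_k| ≤
η is realised EXACTLY (barlowCoupling W 1 √(2/3) k = J_k, k ≥ 2) by a continuous tail 0 ≤ W ≤ Cη
e^(−r²) vanishing on [0, 3/2]. Construction: two radii per layer distance k — r⁺_k = k√(2/3) (the
on-axis aligned point, registry coefficient +1) and r⁻_k = √((2k²+1)/3) (the three nearest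
non-aligned points, coefficient −3) — carrying non-negative bumps of width 1/(100k) (all squared
Barlow distances lie in (1/3)ℕ, so shells are isolated); a shell of radius < (k+1)√(2/3) touches
only layers ≤ k (strictly triangular), cross-talk counts are ≤ C·k, and with the weight 4^(k²) the
downward solve is a contraction; signs are chosen by which radius carries the mass. [difficulty: M] -/
@[route_item "route-AtomisticToContinuum-RadialAperiodicTwin"]
def RegistryRealisation : Prop :=
  ∃ C : ℝ, 0 < C ∧ ∀ (J : ℕ → ℝ) (η : ℝ), 0 < η → J 0 = 0 → J 1 = 0 → Summable (fun k : ℕ => (4 : ℝ) ^ (k ^ 2) * |J k|) → (∑' k : ℕ, (4 : ℝ) ^ (k ^ 2) * |J k|) ≤ η → ∃ W : ℝ → ℝ, Continuous W ∧ (∀ r : ℝ, 0 ≤ W r ∧ W r ≤ C * η * Real.exp (-r ^ 2)) ∧ (∀ r : ℝ, r ≤ 3 / 2 → W r = 0) ∧ ∀ k : ℕ, 2 ≤ k → Literature.MathematicalPhysics.StatisticalMechanics.barlowCoupling W 1 (Real.sqrt (2 / 3)) k = J k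

/-- item stmt-AtomisticToContinuum-7342 · support · rank 9 · closed · moot by None · by planner
sources: BlancLewin2015, Hales2012
[support] FINITE WALLS ENCODE THE HARD CORE. (a) In any finite configuration of ℝ³ the number of
unit-distance pairs is ≤ A·N + B·#(pairs at distance < 1) (grid of cubes of side 1/2: U ≤ 343·X +
172·N); (b) hence for M ≥ M₀ and any tail 0 ≤ W ≤ e^(−r²) every ground state of V = M·1[r<1] −
1[r=1] + W·1[r>1] is a unit packing (remove all overlap-affected particles — they carry ≤ 13·(their
number) outside contacts since clean neighbours kiss ≤ 12 — and re-insert them as a far FCC blob; W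
≥ 0 makes removal free). [difficulty: provable-now] -/
@[route_item "route-AtomisticToContinuum-RadialAperiodicTwin"]
def OverlapRemoval : Prop :=
  (∃ A B : ℝ, ∀ (N : ℕ) (x : Fin N → EuclideanSpace ℝ (Fin 3)), ((Finset.univ.filter fun q : Fin N × Fin N => q.1 < q.2 ∧ dist (x q.1) (x q.2) = 1).card : ℝ) ≤ A * N + B * ((Finset.univ.filter fun q : Fin N × Fin N => q.1 < q.2 ∧ dist (x q.1) (x q.2) < 1).card : ℝ)) ∧ ∃ M₀ : ℝ, ∀ (M : ℝ) (W : ℝ → ℝ), M₀ ≤ M → (∀ r : ℝ, 0 ≤ W r ∧ W r ≤ Real.exp (-r ^ 2)) → let V : ℝ → ℝ := fun r => if r < 1 then M else if r = 1 then -1 else W r; ∀ (N : ℕ) (x : Fin N → EuclideanSpace ℝ (Fin 3)), Literature.MathematicalPhysics.StatisticalMechanics.IsGroundState V x → ∀ i j : Fin N, i ≠ j → 1 ≤ dist (x i) (x j)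

/-- item stmt-AtomisticToContinuum-7343 · support · rank 9 · closed · moot by None · by planner
sources: BlancLewin2015, HeitmannRadin1980, Theil2006
[support] HONESTY OF THE WITNESS. For M ≥ M₀ and tails W as in crux 2 with J ≥ 0 (k ≥ 2) and a
zero-energy Hägg word: ground states exist for every N (overlap removal + strict binding: one new
contact beats the Gaussian cross-tail; lower semicontinuity of −#contacts + W on unit packings; no
splitting), e₀ = barlowBaseEnergy V 1 √(2/3) < 0 (= −6 + O(η)), and E(N)/N ≤ e₀ + δ eventually
(trial states: N-point fragments of the zero-energy coded Barlow stacking, surface O(N^(2/3))).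
[difficulty: M] -/
@[route_item "route-AtomisticToContinuum-RadialAperiodicTwin"]
def StickyTailHonesty : Prop :=
  ∃ M₀ η₀ : ℝ, 0 < η₀ ∧ ∀ (M η : ℝ) (W : ℝ → ℝ), M₀ ≤ M → 0 < η → η ≤ η₀ → Continuous W → (∀ r : ℝ, 0 ≤ W r ∧ W r ≤ η * Real.exp (-r ^ 2)) → (∀ r : ℝ, r ≤ 3 / 2 → W r = 0) → let V : ℝ → ℝ := fun r => if r < 1 then M else if r = 1 then -1 else W r; let J : ℕ → ℝ := Literature.MathematicalPhysics.StatisticalMechanics.barlowCoupling W 1 (Real.sqrt (2 / 3)); (∀ k : ℕ, 2 ≤ k → 0 ≤ J k) → (∃ s₀ : ℤ → ℤ, Literature.MathematicalPhysics.StatisticalMechanics.IsHaggSeq s₀ ∧ ∀ (a : ℤ) (n : ℕ), Literature.MathematicalPhysics.StatisticalMechanics.haggEnergy n J (fun i => s₀ (i + a)) = 0) → (∀ N : ℕ, ∃ x : Fin N → EuclideanSpace ℝ (Fin 3), Literature.MathematicalPhysics.StatisticalMechanics.IsGroundState V x) ∧ Literature.MathematicalPhysics.StatisticalMechanics.barlowBaseEnergy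 V 1 (Real.sqrt (2 / 3)) < 0 ∧ ∀ δ : ℝ, 0 < δ → ∀ᶠ N : ℕ in Filter.atTop, Literature.MathematicalPhysics.StatisticalMechanics.groundStateEnergy V 3 N / N ≤ Literature.MathematicalPhysics.StatisticalMechanics.barlowBaseEnergy V 1 (Real.sqrt (2 / 3)) + δ

/-- item stmt-AtomisticToContinuum-7344 · support · rank 9 · closed · moot by None · by planner
sources: arXiv:1906.12103, BlancLewin2015, Radin1991, Suto2006
[support] THE CONJUNCT-(i) TWIN ALONE (closes with crux 2 + the three M-supports, without crux 3):
relative to flyspeck_L12 and Hales2012_contactGraphTame, for every ε > 0 a radial V ε-close to the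
sticky sphere with ground states ∀ N, ⨅_Q e_V(Q) < 0, E(N)/N → ⨅_Q e_V(Q), periodic infimum NOT
attained, ¬HasPeriodicGroundStateEnergy V 3. Fills the catalogue's open seat on the energetic side
and calibrates route RefuteCrystalPeriodicMin's logic on a potential where it is true. [difficulty:
L] -/
@[route_item "route-AtomisticToContinuum-RadialAperiodicTwin"]
def EnergeticTwin : Prop :=
  Literature.Geometry.DiscreteGeometry.flyspeck_L12 → Literature.Geometry.DiscreteGeometry.Hales2012_contactGraphTame → ∀ ε : ℝ, 0 < ε → ∃ V : ℝ → ℝ, V 1 = -1 ∧ (∀ r : ℝ, r < 1 → 1 ≤ V r) ∧ (∀ r : ℝ, 1 < r → 0 ≤ V r ∧ V r ≤ ε) ∧ (∀ N : ℕ, ∃ x : Fin N → EuclideanSpace ℝ (Fin 3), Literature.MathematicalPhysics.StatisticalMechanics.IsGroundState V x) ∧ (⨅ Q : Literature.MathematicalPhysics.StatisticalMechanics.PeriodicConfiguration 3, Q.energyPerParticle V) < 0 ∧ Filter.Tendsto (fun N : ℕ => Literature.MathematicalPhysics.StatisticalMechanics.groundStateEnergy V 3 N / N) Filter.atTop (nhds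 (⨅ Q : Literature.MathematicalPhysics.StatisticalMechanics.PeriodicConfiguration 3, Q.energyPerParticle V)) ∧ (¬ ∃ P : Literature.MathematicalPhysics.StatisticalMechanics.PeriodicConfiguration 3, IsLeast (Set.range fun Q : Literature.MathematicalPhysics.StatisticalMechanics.PeriodicConfiguration 3 => Q.energyPerParticle V) (P.energyPerParticle V)) ∧ ¬ Literature.MathematicalPhysics.StatisticalMechanics.HasPeriodicGroundStateEnergy V 3

/-- item stmt-AtomisticToContinuum-7345 · assembly · rank 1 · closed · moot by None · by planner
sources: BlancLewin2015, Hales2012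
[assembly] StickyPeriodicReduction → BulkStackingReadout → RotationCodedChain → RegistryRealisation
→ StickyTailHonesty → AperiodicRadialPotential. -/
@[route_item "route-AtomisticToContinuum-RadialAperiodicTwin"]
def Assembly : Prop :=
  StickyPeriodicReduction → BulkStackingReadout → RotationCodedChain → RegistryRealisation → StickyTailHonesty → AperiodicRadialPotential

end Summit.AtomisticToContinuum.Crystallization.Theses.RadialAperiodicTwin
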